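import Summits.QuantumFields.BalabanUV.T4Continuum.Support.NE7BalabanSoftOperatorMass
import HarnessLib

/-!
# NE7ConstrainedGreenSymmetricMass — F196∕F198 FOR THE SOFT OPERATOR WITH A FREE MASS COEFFICIENT: (KL-B) in source form from (P_a) «`softSymOpKa a = HessSym_W + D_W R(W) D_W* +
# a·Qbar*Qbar` positive definite» ([B9] Thm 3.11's statement for `Δ_a(U)` with print's own `a`) + the sup-VALUE and sup-CURL rows of the named constrained propagator
# `cGreenSymKa` (Thm 3.3 (3.42)₁,₂∕(3.49) SHAPE) + the tension letter + `2·card n·τ·K₀ ≤ 1`, constant `2K` (file 132 of the curved (APE), F203)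

Cell `pub-balaban`, rung (B)+1 sub-cell t4, lineage `b2b-balaban-t4-ne7-p1` (CRUX PROVER NE7 #1 = OWNER of row NE7), generation 85; memo
`t4/b2b-balaban-t4-ne7-p1-g85/LAGRANGE-CARRIER.md` §9.  Over F202 `NE7BalabanSoftOperatorMass`, F196 `NE7ConstrainedGreenSymmetricCarrier` (`hessSymOpK_eq_of_lagrangeForm`,
`exists_antisymmetricSource`, `srcPair_add_left`), F193 (`qbarOpK_eq_zero_iff`, `landauProj_adjoint_grad_eq_zero_iff`), F191 (`sliceEq_lagrangeForm`), F166 BY NAME — the proofs are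
F196 §3–§4 and F198 §5 verbatim with `A = a·id` in place of `M⁻²·id`.
WHY.  See F202: the mass coefficient of F192 is print's only up to `M^{d−4}`; the positivity letter should be displayed for print's `a`.  The constrained propagator and hence the
rows (C) do not depend on `a`; F166 allows any `A`.
WHAT ([folklore]; 0 def, 0 sorry).  §1 `resF_eq_constrainedGreen_symmA`; §2 `sourceLetter_of_symmetric_rowsA`; §3 **`sourceLetter_of_posDef_rowsA`** — F173's `hSrc` at
`Gauge := IsLandauB8` (constant `2K`) from (P_a), the rows `K₀`, `K` of `cGreenSymKa`, the tension letter `τ` and `2·card n·τ·K₀ ≤ 1`.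
HONEST FRAMING (page 1): finite-dimensional linear algebra + one bootstrap; NO estimate; (P_a) and the rows are DISPLAYED HYPOTHESES (NOT proved; identification with print's operators NOT
made here); (KL-B) at curved `W` NOT proved; (APE) on curved data NOT proved; NOT ONE-STEP, NOT NE7; spine 0∕9; finite T⁴ rung (B)+1 — NOT infinite volume, NOT mass gap, NOT
`BetaPertH`, NOT Clay.  Continuum YM on T⁴ ⇐ BetaPertH ∧ nine spine estimates (0/9 proved); BetaPertH ⇐ (D1) ∧ (D4) ∧ CAP+tail; G-an2-4 gates asym, D1 and NE2/3/4.
-/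

set_option autoImplicit false

open scoped BigOperators InnerProductSpace Matrix Matrix.Norms.L2Operator
open Finset

namespace Summit.QuantumFields.BalabanUV.T4Continuum.NE7ConstrainedGreenSymmetricMass

open Literature.MathematicalPhysics.QuantumFieldTheory.Balaban1983to89
open B7Prop1Explicit B7Prop2Explicit UnitaryModel
open T4AveragingDeficitWall (IsUnitaryCfg IsSkewDir SmallField curlAt dirL1)
open T4AveragingDeficitWallBoundary (periodBox IsPeriodicCfg)
open AveragingDeficitPeriodicCounting (IsPeriodicDir)
open AveragingDeficitMultiLevelPrep (LevelSmall)
open AveragingDeficitTorusChart (redN)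
open MinimalActionLevels (perWin)
open NE3HessForm (hess dAction)
open NE3EnergyHessBilin (hessSym)
open NE3TangentCovariantTower (QbarIter)
open NE3HilbertSchmidtTorus
open NE3QbarIterCovLiftPrep (cruxC)
open NE3.PairLandauB8 (IsLandauB8)
open NE7FlatSliceSourceDuality (srcPair periodic_eq_boxVec_redN)
open NE7SliceLagrangeMultiplier (sliceEq_lagrangeForm)
open NE7ConstrainedGreenIdentity (constrainedGreen)
open NE7ConstrainedGreenBalabanGauge (eq_source_of_gaugeFixed)
open NE7BalabanSoftOperator
open NE7ConstrainedGreenOnCarrier (qbarOpK_eq_zero_iff landauProj_adjoint_grad_eq_zero_iff)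
open NE7ConstrainedGreenSymmetricCarrier (srcPair_add_left hessSymOpK_eq_of_lagrangeForm exists_antisymmetricSource)
open NE7BalabanSoftOperatorMass

noncomputable section

variable {d : ℕ} {n : Type*} [Fintype n] [DecidableEq n]

section Carrier

variable [Nonempty n] {L N : ℕ} [NeZero N] (hL : 1 ≤ L) (j : ℕ) [NeZero (N * L ^ (j + 1))]
  {W : Site d → Fin d → (Matrix n n ℂ)ˣ} {x : ℝ} (hWu : IsUnitaryCfg W) (hWP : IsPeriodicCfg W ((N * L ^ (j + 1) : ℕ) : ℤ))
  (hx : 0 ≤ x) (hs : LevelSmall d L j x) (hWx : SmallField W x)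

/-! ## §1 The gauge-fixed slice solution is `C(H + H_a)` for `softSymOpKa a` -/

include hWP in
/-- **F166 ON THE CARRIER for `softSymOpKa a`.**  `X″` skew periodic on Bałaban's slice in the (1.38) gauge solving `hess W X″ Y = ⟨H, Y⟩` on the straight-tangent tests, `H_a` the
shift source of §2: for every left inverse `G` of `softSymOpKa a` and `Dinv` of `Qbar G Qbar*`, `resF X″ = constrainedGreen G Qbar Qbar* Dinv (resF (H + H_a))`. [folklore] -/
theorem resF_eq_constrainedGreen_symmA (a : ℝ)
    (G : skewForms d n (N * L ^ (j + 1)) →ₗ[ℝ] skewForms d n (N * L ^ (j + 1))) (hGS : ∀ y, G (softSymOpKa hL j hWu hx hs hWx a y) = y)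
    (Dinv : skewForms d n N →ₗ[ℝ] skewForms d n N)
    (hD' : ∀ f, Dinv (qbarOpK (N := N) hL j hWu hx hs hWx (G
      ((LinearMap.adjoint (𝕜 := ℝ) (E := skewForms d n (N * L ^ (j + 1))) (F := skewForms d n N) (qbarOpK (N := N) hL j hWu hx hs hWx)
          : skewForms d n N →ₗ[ℝ] skewForms d n (N * L ^ (j + 1))) f))) = f)
    {X'' H Ha : Site d → Fin d → Matrix n n ℂ} (hXs : IsSkewDir X'') (hXP : IsPeriodicDir X'' ((N * L ^ (j + 1) : ℕ) : ℤ))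
    (hXQ : QbarIter L (j + 1) W X'' = 0) (hXG : IsLandauB8 (d := d) L N (j + 1) W X'')
    (hHP : IsPeriodicDir H ((N * L ^ (j + 1) : ℕ) : ℤ)) (hHaP : IsPeriodicDir Ha ((N * L ^ (j + 1) : ℕ) : ℤ))
    (heq : ∀ Y : Site d → Fin d → Matrix n n ℂ, IsSkewDir Y → IsPeriodicDir Y ((N * L ^ (j + 1) : ℕ) : ℤ) → QbarIter L (j + 1) W Y = 0 →
      hess W X'' Y (perWin d (N * L ^ (j + 1))) = srcPair H Y (periodBox (d := d) (N * L ^ (j + 1))))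
    (hshift : ∀ Y : Site d → Fin d → Matrix n n ℂ, IsSkewDir Y → IsPeriodicDir Y ((N * L ^ (j + 1) : ℕ) : ℤ) →
      hessSym W (perWin d (N * L ^ (j + 1))) X'' Y = hess W X'' Y (perWin d (N * L ^ (j + 1))) + srcPair Ha Y (periodBox (d := d) (N * L ^ (j + 1))))
    (hsum : IsSkewDir (fun y κ => H y κ + Ha y κ)) :
    (⟨resF (N * L ^ (j + 1)) X'', resF_mem_skewForms hXs⟩ : skewForms d n (N * L ^ (j + 1)))
      = constrainedGreen G (qbarOpK (N := N) hL j hWu hx hs hWx)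
          (LinearMap.adjoint (𝕜 := ℝ) (E := skewForms d n (N * L ^ (j + 1))) (F := skewForms d n N) (qbarOpK (N := N) hL j hWu hx hs hWx)
              : skewForms d n N →ₗ[ℝ] skewForms d n (N * L ^ (j + 1)))
          Dinv ⟨resF (N * L ^ (j + 1)) (fun y κ => H y κ + Ha y κ), resF_mem_skewForms hsum⟩ := by
  -- the multiplier of the mixed equation (F191)
  obtain ⟨μ, hμs, hμP, hμ⟩ := sliceEq_lagrangeForm hL j hWu hWP hx hs hWx (X'' := X'') (H := H) heq
  have hsumP : IsPeriodicDir (fun y κ => H y κ + Ha y κ) ((N * L ^ (j + 1) : ℕ) : ℤ) := fun y κ μ' => by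
    show H (y + ((N * L ^ (j + 1) : ℕ) : ℤ) • e κ) μ' + Ha (y + ((N * L ^ (j + 1) : ℕ) : ℤ) • e κ) μ' = H y μ' + Ha y μ'
    rw [hHP, hHaP]
  set b : skewForms d n (N * L ^ (j + 1)) := ⟨resF (N * L ^ (j + 1)) X'', resF_mem_skewForms hXs⟩ with hb
  set h' : skewForms d n (N * L ^ (j + 1)) := ⟨resF (N * L ^ (j + 1)) (fun y κ => H y κ + Ha y κ), resF_mem_skewForms hsum⟩ with hh'
  set m : skewForms d n N := ⟨resF N μ, resF_mem_skewForms hμs⟩ with hm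
  have hbX : extF (N * L ^ (j + 1)) (b : Form d n (N * L ^ (j + 1))) = X'' := extF_resF _ hXP
  have hhH : extF (N * L ^ (j + 1)) (h' : Form d n (N * L ^ (j + 1))) = fun y κ => H y κ + Ha y κ := extF_resF _ hsumP
  have hmμ : extF N (m : Form d n N) = μ := extF_resF _ hμP
  -- the symmetric Lagrange form
  have hsrc := hessSymOpK_eq_of_lagrangeForm hL j hWu hx hs hWx b h' m (fun Y hYs hYP => by
    rw [hbX, hhH, hmμ, hshift Y hYs hYP, hμ Y hYs hYP, srcPair_add_left]
    ring)
  have hxQ : qbarOpK (N := N) hL j hWu hx hs hWx b = 0 := by rw [qbarOpK_eq_zero_iff hL j hWu hWP hx hs hWx, hbX]; exact hXQ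
  have hgauge := (landauProj_adjoint_grad_eq_zero_iff j hWu hWP b).mpr (by rw [hbX]; exact hXG)
  exact eq_source_of_gaugeFixed (softSymOpKa hL j hWu hx hs hWx a) (hessSymOpK W (N * L ^ (j + 1))) G (qbarOpK (N := N) hL j hWu hx hs hWx)
    (LinearMap.adjoint (𝕜 := ℝ) (E := skewForms d n (N * L ^ (j + 1))) (F := skewForms d n N) (qbarOpK (N := N) hL j hWu hx hs hWx))
    (a • LinearMap.id) Dinv (gradOpK hWu (N * L ^ (j + 1))) (landauProjK L N (j + 1) W)
    (LinearMap.adjoint (𝕜 := ℝ) (E := skewSecs d n (N * L ^ (j + 1))) (F := skewForms d n (N * L ^ (j + 1))) (gradOpK hWu (N * L ^ (j + 1))))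
    (softSymOpKa_apply hL j hWu hx hs hWx a) hGS hD' hxQ hgauge hsrc

/-! ## §2 The SOURCE form of (KL-B) from the rows, by bootstrap -/

include hWP in
/-- **(KL-B) IN SOURCE FORM FROM LETTERS ABOUT `softSymOpKa a`.**  HYPOTHESES (displayed, NOT proved): the tension letter `τ`
(discharged in the class by `NE7TensionRadiusOfFluxGradient`); a left inverse `G` of `softSymOpKa a` and `Dinv` of `Qbar G Qbar*` (EXISTENCE = positivity, Thm 3.11 TYPE); the sup-VALUE
row `K₀` and the sup-CURL row `K` of `C = constrainedGreen G Qbar Qbar* Dinv` (Thm 3.3 entries `|GJ|`, `|∇_UGJ|` + (3.49) TYPE); the class-smallness `2·card n·τ·K₀ ≤ 1`.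
CONCLUSION: F173's `hSrc` at `Gauge := IsLandauB8 L N (j+1) W` with constant `2K`. [folklore] -/
theorem sourceLetter_of_symmetric_rowsA (a : ℝ) {τ : ℝ} (hτ : 0 ≤ τ)
    (hten : ∀ K : Site d → Fin d → Matrix n n ℂ, IsSkewDir K → IsPeriodicDir K ((N * L ^ (j + 1) : ℕ) : ℤ) →
      |dAction W K (perWin d (N * L ^ (j + 1)))| ≤ τ * dirL1 K (periodBox (d := d) (N * L ^ (j + 1))))
    (G : skewForms d n (N * L ^ (j + 1)) →ₗ[ℝ] skewForms d n (N * L ^ (j + 1))) (hGS : ∀ y, G (softSymOpKa hL j hWu hx hs hWx a y) = y)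
    (Dinv : skewForms d n N →ₗ[ℝ] skewForms d n N)
    (hD' : ∀ f, Dinv (qbarOpK (N := N) hL j hWu hx hs hWx (G
      ((LinearMap.adjoint (𝕜 := ℝ) (E := skewForms d n (N * L ^ (j + 1))) (F := skewForms d n N) (qbarOpK (N := N) hL j hWu hx hs hWx)
          : skewForms d n N →ₗ[ℝ] skewForms d n (N * L ^ (j + 1))) f))) = f)
    {K₀ K : ℝ} (hK : 0 ≤ K)
    (hC0 : ∀ h : skewForms d n (N * L ^ (j + 1)), ∀ g : ℝ, (∀ (y : Site d) (κ : Fin d), ‖extF (N * L ^ (j + 1)) (h : Form d n (N * L ^ (j + 1))) y κ‖ ≤ g) →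
      ∀ (y : Site d) (κ : Fin d),
        ‖extF (N * L ^ (j + 1)) ((constrainedGreen G (qbarOpK (N := N) hL j hWu hx hs hWx)
            (LinearMap.adjoint (𝕜 := ℝ) (E := skewForms d n (N * L ^ (j + 1))) (F := skewForms d n N) (qbarOpK (N := N) hL j hWu hx hs hWx)
                : skewForms d n N →ₗ[ℝ] skewForms d n (N * L ^ (j + 1)))
            Dinv h : skewForms d n (N * L ^ (j + 1))) : Form d n (N * L ^ (j + 1))) y κ‖ ≤ K₀ * g)
    (hC1 : ∀ h : skewForms d n (N * L ^ (j + 1)), ∀ g : ℝ, (∀ (y : Site d) (κ : Fin d), ‖extF (N * L ^ (j + 1)) (h : Form d n (N * L ^ (j + 1))) y κ‖ ≤ g) →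
      ∀ (z : Site d) (μ' ν' : Fin d), μ' ≠ ν' →
        ‖curlAt W (extF (N * L ^ (j + 1)) ((constrainedGreen G (qbarOpK (N := N) hL j hWu hx hs hWx)
            (LinearMap.adjoint (𝕜 := ℝ) (E := skewForms d n (N * L ^ (j + 1))) (F := skewForms d n N) (qbarOpK (N := N) hL j hWu hx hs hWx)
                : skewForms d n N →ₗ[ℝ] skewForms d n (N * L ^ (j + 1)))
            Dinv h : skewForms d n (N * L ^ (j + 1))) : Form d n (N * L ^ (j + 1)))) z μ' ν'‖ ≤ K * g)
    (hsmall : 2 * (Fintype.card n * τ) * K₀ ≤ 1) :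
    ∀ X'' : Site d → Fin d → Matrix n n ℂ, IsSkewDir X'' → IsPeriodicDir X'' ((N * L ^ (j + 1) : ℕ) : ℤ) → QbarIter L (j + 1) W X'' = 0 →
      IsLandauB8 (d := d) L N (j + 1) W X'' →
      ∀ H : Site d → Fin d → Matrix n n ℂ, IsSkewDir H → IsPeriodicDir H ((N * L ^ (j + 1) : ℕ) : ℤ) → ∀ g : ℝ, 0 ≤ g → (∀ (y : Site d) (κ : Fin d), ‖H y κ‖ ≤ g) →
      (∀ Y : Site d → Fin d → Matrix n n ℂ, IsSkewDir Y → IsPeriodicDir Y ((N * L ^ (j + 1) : ℕ) : ℤ) → QbarIter L (j + 1) W Y = 0 →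
        hess W X'' Y (perWin d (N * L ^ (j + 1))) = srcPair H Y (periodBox (d := d) (N * L ^ (j + 1)))) →
      ∀ (z : Site d) (μ' ν' : Fin d), μ' ≠ ν' → ‖curlAt W X'' z μ' ν'‖ ≤ (2 * K) * g := by
  intro X'' hXs hXP hXQ hXG H hHs hHP g hg hHb heq z μ' ν' hne
  -- the sup of `X″` over one period, attained
  obtain ⟨p₀, -, hp₀⟩ := Finset.exists_max_image (Finset.univ : Finset ((Fin d → Fin (N * L ^ (j + 1))) × Fin d))
    (fun p => ‖X'' (boxVec (N * L ^ (j + 1)) p.1) p.2‖) ⟨(fun _ => 0, μ'), Finset.mem_univ _⟩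
  set s : ℝ := ‖X'' (boxVec (N * L ^ (j + 1)) p₀.1) p₀.2‖ with hsdef
  have hs0 : 0 ≤ s := norm_nonneg _
  have hXsup : ∀ (y : Site d) (κ : Fin d), ‖X'' y κ‖ ≤ s := fun y κ => by
    rw [periodic_eq_boxVec_redN hXP y κ]
    exact hp₀ (redN (N * L ^ (j + 1)) y, κ) (Finset.mem_univ _)
  -- the shift source and the representation `X″ = C_sym(H + H_a)`
  obtain ⟨Ha, hHas, hHaP, hHab, hshift⟩ := exists_antisymmetricSource (N := N) (L := L) j (W := W) hτ hten hXs hXP hs0 hXsup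
  have hsum : IsSkewDir (fun y κ => H y κ + Ha y κ) := fun y κ => (skewAdjoint (Matrix n n ℂ)).add_mem (hHs y κ) (hHas y κ)
  have hsumP : IsPeriodicDir (fun y κ => H y κ + Ha y κ) ((N * L ^ (j + 1) : ℕ) : ℤ) := fun y κ μ'' => by
    show H (y + ((N * L ^ (j + 1) : ℕ) : ℤ) • e κ) μ'' + Ha (y + ((N * L ^ (j + 1) : ℕ) : ℤ) • e κ) μ'' = H y μ'' + Ha y μ''
    rw [hHP, hHaP]
  have hmain := resF_eq_constrainedGreen_symmA hL j hWu hWP hx hs hWx a G hGS Dinv hD' hXs hXP hXQ hXG hHP hHaP heq hshift hsum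
  set h' : skewForms d n (N * L ^ (j + 1)) := ⟨resF (N * L ^ (j + 1)) (fun y κ => H y κ + Ha y κ), resF_mem_skewForms hsum⟩ with hh'
  have hX : X'' = extF (N * L ^ (j + 1)) ((constrainedGreen G (qbarOpK (N := N) hL j hWu hx hs hWx)
            (LinearMap.adjoint (𝕜 := ℝ) (E := skewForms d n (N * L ^ (j + 1))) (F := skewForms d n N) (qbarOpK (N := N) hL j hWu hx hs hWx)
                : skewForms d n N →ₗ[ℝ] skewForms d n (N * L ^ (j + 1)))
            Dinv h' : skewForms d n (N * L ^ (j + 1))) : Form d n (N * L ^ (j + 1))) := by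
    rw [← hmain, Submodule.coe_mk, extF_resF _ hXP]
  -- the source size `g′ = g + card n·τ·s`
  have hg' : ∀ (y : Site d) (κ : Fin d), ‖extF (N * L ^ (j + 1)) (h' : Form d n (N * L ^ (j + 1))) y κ‖ ≤ g + Fintype.card n * (τ * s) := fun y κ => by
    rw [hh', Submodule.coe_mk, extF_resF _ hsumP]
    exact (norm_add_le _ _).trans (add_le_add (hHb y κ) (hHab y κ))
  -- bootstrap of the sup by the VALUE row
  have hsup : s ≤ K₀ * (g + Fintype.card n * (τ * s)) := by
    have h := hC0 h' _ hg' (boxVec (N * L ^ (j + 1)) p₀.1) p₀.2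
    rwa [← hX] at h
  have hs2 : s ≤ 2 * K₀ * g := by nlinarith [mul_nonneg (mul_nonneg (Nat.cast_nonneg (Fintype.card n)) hτ) hs0]
  -- the CURL row
  have hcurl := hC1 h' _ hg' z μ' ν' hne
  rw [← hX] at hcurl
  calc ‖curlAt W X'' z μ' ν'‖ ≤ K * (g + Fintype.card n * (τ * s)) := hcurl
    _ ≤ K * (g + Fintype.card n * (τ * (2 * K₀ * g))) := by gcongr
    _ = K * (1 + 2 * (Fintype.card n * τ) * K₀) * g := by ring
    _ ≤ K * (1 + 1) * g := by gcongr
    _ = (2 * K) * g := by ring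


/-! ## §3 From (P_a) + the rows of `cGreenSymKa` -/

include hWP in
/-- **(KL-B) IN SOURCE FORM FROM (P_a) = [B9] Thm 3.11 (for `Δ_a(W)` with print's `a`) + Thm 3.3∕(3.49) SHAPES (rows of `cGreenSymKa`).**  HYPOTHESES (displayed, NOT proved):
`softSymOpKa a` positive definite; the sup-VALUE row `K₀` and sup-CURL row `K` of `cGreenSymKa`; the tension letter `τ`; `2·card n·τ·K₀ ≤ 1`.  CONCLUSION: F173's `hSrc` at
`Gauge := IsLandauB8` with constant `2K`. [folklore] -/
theorem sourceLetter_of_posDef_rowsA (hL2 : 2 ≤ L) (hθ : cruxC d L * (((L : ℝ) ^ (j + 1)) ^ 2 * x) < 1) (a : ℝ)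
    (hpos : ∀ b : skewForms d n (N * L ^ (j + 1)), b ≠ 0 → 0 < ⟪b, softSymOpKa (N := N) hL j hWu hx hs hWx a b⟫_ℝ)
    {τ : ℝ} (hτ : 0 ≤ τ)
    (hten : ∀ K : Site d → Fin d → Matrix n n ℂ, IsSkewDir K → IsPeriodicDir K ((N * L ^ (j + 1) : ℕ) : ℤ) →
      |dAction W K (perWin d (N * L ^ (j + 1)))| ≤ τ * dirL1 K (periodBox (d := d) (N * L ^ (j + 1))))
    {K₀ K : ℝ} (hK : 0 ≤ K)
    (hC0 : ∀ h : skewForms d n (N * L ^ (j + 1)), ∀ g : ℝ, (∀ (y : Site d) (κ : Fin d), ‖extF (N * L ^ (j + 1)) (h : Form d n (N * L ^ (j + 1))) y κ‖ ≤ g) →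
      ∀ (y : Site d) (κ : Fin d),
        ‖extF (N * L ^ (j + 1)) ((cGreenSymKa hL j hWu hx hs hWx hWP hL2 hθ a hpos h : skewForms d n (N * L ^ (j + 1))) : Form d n (N * L ^ (j + 1))) y κ‖ ≤ K₀ * g)
    (hC1 : ∀ h : skewForms d n (N * L ^ (j + 1)), ∀ g : ℝ, (∀ (y : Site d) (κ : Fin d), ‖extF (N * L ^ (j + 1)) (h : Form d n (N * L ^ (j + 1))) y κ‖ ≤ g) →
      ∀ (z : Site d) (μ' ν' : Fin d), μ' ≠ ν' →
        ‖curlAt W (extF (N * L ^ (j + 1)) ((cGreenSymKa hL j hWu hx hs hWx hWP hL2 hθ a hpos h : skewForms d n (N * L ^ (j + 1))) : Form d n (N * L ^ (j + 1)))) z μ' ν'‖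
          ≤ K * g)
    (hsmall : 2 * (Fintype.card n * τ) * K₀ ≤ 1) :
    ∀ X'' : Site d → Fin d → Matrix n n ℂ, IsSkewDir X'' → IsPeriodicDir X'' ((N * L ^ (j + 1) : ℕ) : ℤ) → QbarIter L (j + 1) W X'' = 0 →
      IsLandauB8 (d := d) L N (j + 1) W X'' →
      ∀ H : Site d → Fin d → Matrix n n ℂ, IsSkewDir H → IsPeriodicDir H ((N * L ^ (j + 1) : ℕ) : ℤ) → ∀ g : ℝ, 0 ≤ g → (∀ (y : Site d) (κ : Fin d), ‖H y κ‖ ≤ g) →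
      (∀ Y : Site d → Fin d → Matrix n n ℂ, IsSkewDir Y → IsPeriodicDir Y ((N * L ^ (j + 1) : ℕ) : ℤ) → QbarIter L (j + 1) W Y = 0 →
        hess W X'' Y (perWin d (N * L ^ (j + 1))) = srcPair H Y (periodBox (d := d) (N * L ^ (j + 1)))) →
      ∀ (z : Site d) (μ' ν' : Fin d), μ' ≠ ν' → ‖curlAt W X'' z μ' ν'‖ ≤ (2 * K) * g :=
  sourceLetter_of_symmetric_rowsA hL j hWu hWP hx hs hWx a hτ hten (softSymGreenKa hL j hWu hx hs hWx a hpos)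
    (softSymGreenKa_apply_softSymOpKa hL j hWu hx hs hWx a hpos) (softSymDinvKa hL j hWu hx hs hWx hWP hL2 hθ a hpos)
    (softSymDinvKa_apply hL j hWu hWP hx hs hWx hL2 hθ a hpos) hK hC0 hC1 hsmall

end Carrier

end

end Summit.QuantumFields.BalabanUV.T4Continuum.NE7ConstrainedGreenSymmetricMass
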